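import Summits.HubbardSuperconductivity.HubbardSuperconductivity.Theorems.ParityGapRigidityParityGapClustering
import Literature.MathematicalPhysics.QuantumLattice.MomentumDistributionLipschitz
import HarnessLib

/-!
# Route ParityGapRigidity — crux `GappedWindow` (stmt-HubbardSuperconductivity-2196):
# a uniform parity gap excludes any Fermi-surface discontinuity of the momentum distribution

Helper file (`--supports stmt-HubbardSuperconductivity-2198`, the route's kill criterion, which has no
registered stubs; periphery of the crux stmt-2196, line `registered`, lead c5, cycle 2). A NECESSARY
condition on the window of the crux
`Summit.HubbardSuperconductivity.HubbardSuperconductivity.Theses.ParityGapRigidity.GappedWindow`, now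
unconditional because the route's sector-relative Hastings–Koma lemma `ParityGapClustering`
(stmt-2197) is a theorem of the tree (`parityGapClustering_proof`):

* `momentumDistribution_lipschitz_of_parityGap` — for every `U` and `Δ > 0` there is ONE `K ≥ 0`
  such that on every torus `(ℤ/Lℤ)²` and in every sector `(N, S^z = 0)`, a normalised sector ground
  state `ψ` of `hubbardTorus 2 L 1 U` with one-particle parity gap
  `E(N+1) + E(N-1) - 2E₀(N,0) ≥ 2Δ` has an `L`-uniformly Lipschitz momentum distribution:
  `|n_σ(k) - n_σ(k')| ≤ K · dist(k,k') / L` for all Bloch momenta `k, k'` (`n_σ(k) = ⟨ψ, c†_{kσ}c_{kσ} ψ⟩`,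
  `dist` the periodic sup-distance on the dual torus, mesh `2π/L`). Chain: parity gap ⇒(HK, 2197)
  `|ρ₁| ≤ C e^{-m dist}` ⇒(Fourier, `abs_re_expect_momentumNumber_sub_le_of_clustering`)
  Lipschitz with `K = 16π C S_m`;
* `momentumDistribution_lipschitz_of_parityGap_clause` — the (PG) clause of `GappedWindow` at
  `(U, δ)`, verbatim, gives the same for every `(N_L, 0)`-sector ground state, eventually in even `L`;
* `gappedWindow_momentumDistribution_lipschitz` — the crux BY NAME ⇒ its window carries no
  Fermi-surface jump: neighbouring momenta have occupations within `K/L`;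
* `not_parityGap_clause_of_fermiJump` — **contrapositive, a new sufficient condition for the kill
  criterion** `NoUniformParityGap` (stmt-2198) at a point `(U, δ)`: a Migdal discontinuity — some
  `z > 0` such that for infinitely many even `L` some normalised `(N_L, 0)`-sector ground state has
  two momenta at dual distance `≤ 1` whose occupations differ by `≥ z` — refutes the (PG) clause
  there; `not_gappedWindow_of_forall_fermiJump` — a jump at EVERY `(U, δ)`, `U > 0`, `0 < δ < 1/2`,
  refutes `GappedWindow`.

Reading for planners/refuters. (PG) is false in a Landau Fermi liquid not only through the `1/L²`
level spacing (route card) but through the quasiparticle residue: `Z > 0` along even `L` is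
incompatible with ANY `L`-uniform parity gap, whatever `(H2)–(H4)`, (DOM) do. The refuter
instrument for W therefore need not resolve three sector energies to `o(1)`; a ground-state
momentum-distribution jump suffices. At the Kohn–Luttinger candidate the believed `n(k)` is smooth
on the scale `Δ/v_F ~ e^{-c/U²}`, i.e. `K ~ e^{+c/U²}` — consistent, and quantifies how large `L₀`
of the window must be (`L₀ ≳ K`). Nothing here bears on the open stub S of the line (see
`Cruxes/GappedWindow/Lines/registered-dead.md`).

No definitions. Reused: `parityGapClustering_proof` (2197), the tree's momentum modes
`momentumNumber` (`ReducedBCSTorus`), `abs_re_expect_momentumNumber_sub_le_of_clustering`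
(`MomentumDistributionLipschitz`). Sources: Hastings–Koma, CMP 265 (2006) 781 (clustering);
A. B. Migdal, Sov. Phys. JETP 5 (1957) 333 (the jump); folklore Fourier analysis.
-/

noncomputable section

-- the mandated namespace `Summit.<Summit>.<Problem>.Theorems` repeats `HubbardSuperconductivity`
-- (single-problem summit, D-0017), which the `dupNamespace` linter flags on every declaration
set_option linter.dupNamespace false

namespace Summit.HubbardSuperconductivity.HubbardSuperconductivity.Theorems

open Summit.HubbardSuperconductivity.HubbardSuperconductivity.Theses.ParityGapRigidity
open Literature.MathematicalPhysics.QuantumLattice Literature.Probability.LatticeModels Matrix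
open scoped Real

/-- **A parity gap makes the momentum distribution `L`-uniformly Lipschitz.** For every `U` and
`Δ > 0` there is `K ≥ 0` such that on every torus side `L ≥ 1`, in every sector `(N, S^z = 0)`, every
normalised sector ground state `ψ` of `hubbardTorus 2 L 1 U` with
`E(N+1) + E(N-1) - 2E₀(N,0) ≥ 2Δ` has `|Re⟨n_{kσ}⟩_ψ - Re⟨n_{k'σ}⟩_ψ| ≤ K · dist(k,k') / L` for all
momenta `k, k'` and both spins (`K = 16π · max(C,0) · S_m` with `(C, m)` the clustering data of
`parityGapClustering_proof`). -/
theorem momentumDistribution_lipschitz_of_parityGap (U : ℝ) {Δ : ℝ} (hΔ : 0 < Δ) :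
    ∃ K : ℝ, 0 ≤ K ∧ ∀ (L : ℕ) [NeZero L] (N : ℕ) (ψ : Fock (Orb (FermionTorus 2 L))),
      IsGroundStateInSector (hubbardTorus 2 L 1 U) N 0 ψ → star ψ ⬝ᵥ ψ = 1 →
      2 * Δ ≤ groundEnergy (hubbardTorus 2 L 1 U) (N + 1) +
          groundEnergy (hubbardTorus 2 L 1 U) (N - 1) -
          2 * Matrix.minEnergyOn (hubbardTorus 2 L 1 U) (szSector N 0) →
      ∀ (σ : Fin 2) (k k' : TorusSite 2 L),
        |(expect (momentumNumber k σ) ψ).re - (expect (momentumNumber k' σ) ψ).re| ≤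
          K * torusDist k k' / L := by
  obtain ⟨C, m, hm, hcl⟩ := parityGapClustering_proof U Δ hΔ
  set S : ℝ := ∑' r : ℕ, (2 * (r : ℝ) + 1) * ((r : ℝ) * Real.exp (-(m * r))) with hS
  have hS0 : 0 ≤ S := tsum_nonneg fun r => mul_nonneg (by positivity)
    (mul_nonneg (Nat.cast_nonneg r) (Real.exp_nonneg _))
  refine ⟨16 * π * max C 0 * S, by positivity, ?_⟩
  intro L _ N ψ hgs hψ1 hPG σ k k'
  have hcl' := hcl L N _ rfl ψ hgs hψ1 hPG
  refine abs_re_expect_momentumNumber_sub_le_of_clustering (le_max_right C 0) hm σ ψ ?_ k k'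
  intro x y
  exact (hcl' x y σ σ).trans
    (mul_le_mul_of_nonneg_right (le_max_left C 0) (Real.exp_pos _).le)

/-- **The (PG) clause of `GappedWindow` at `(U, δ)`, verbatim, forbids a Fermi-surface jump**:
there are `K ≥ 0` and `L₀` such that for every even `L ≥ L₀` every normalised
`(N_L, S^z = 0)`-sector ground state of `hubbardTorus 2 L 1 U`, `N_L = 2⌊(1-δ)L²/2⌋`, has
`|Re⟨n_{kσ}⟩ - Re⟨n_{k'σ}⟩| ≤ K · dist(k,k') / L`. -/
theorem momentumDistribution_lipschitz_of_parityGap_clause (U δ : ℝ)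
    (hPG : ∃ Δ : ℝ, 0 < Δ ∧ ∃ L₀ : ℕ, ∀ L ≥ L₀, Even L → ∀ Hm, Hm = hubbardTorus 2 L 1 U →
      2 * Δ ≤ groundEnergy Hm (2 * ⌊(1 - δ) * (L : ℝ) ^ 2 / 2⌋₊ + 1) +
        groundEnergy Hm (2 * ⌊(1 - δ) * (L : ℝ) ^ 2 / 2⌋₊ - 1) -
        2 * Matrix.minEnergyOn Hm (szSector (2 * ⌊(1 - δ) * (L : ℝ) ^ 2 / 2⌋₊) 0)) :
    ∃ K : ℝ, 0 ≤ K ∧ ∃ L₀ : ℕ, ∀ (L : ℕ) [NeZero L], L₀ ≤ L → Even L →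
      ∀ ψ : Fock (Orb (FermionTorus 2 L)),
        IsGroundStateInSector (hubbardTorus 2 L 1 U) (2 * ⌊(1 - δ) * (L : ℝ) ^ 2 / 2⌋₊) 0 ψ →
        star ψ ⬝ᵥ ψ = 1 →
        ∀ (σ : Fin 2) (k k' : TorusSite 2 L),
          |(expect (momentumNumber k σ) ψ).re - (expect (momentumNumber k' σ) ψ).re| ≤
            K * torusDist k k' / L := by
  obtain ⟨Δ, hΔ, L₀, hgap⟩ := hPG
  obtain ⟨K, hK, hlip⟩ := momentumDistribution_lipschitz_of_parityGap U hΔ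
  refine ⟨K, hK, L₀, fun L _ hL hev ψ hgs hψ1 σ k k' => ?_⟩
  exact hlip L _ ψ hgs hψ1 (hgap L hL hev _ rfl) σ k k'

/-- **`GappedWindow` ⇒ no Fermi-surface discontinuity in its window.** The crux BY NAME yields
`U > 0`, `δ ∈ (0, 1/2)`, `K ≥ 0` and `L₀` such that every normalised `(N_L, 0)`-sector ground state at
even `L ≥ L₀` has `|Re⟨n_{kσ}⟩ - Re⟨n_{k'σ}⟩| ≤ K · dist(k,k') / L`; neighbouring Bloch momenta
(`dist = 1`) have occupations within `K/L`. -/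
theorem gappedWindow_momentumDistribution_lipschitz (hW : GappedWindow) :
    ∃ U : ℝ, 0 < U ∧ ∃ δ ∈ Set.Ioo (0 : ℝ) (1 / 2), ∃ K : ℝ, 0 ≤ K ∧ ∃ L₀ : ℕ,
      ∀ (L : ℕ) [NeZero L], L₀ ≤ L → Even L →
        ∀ ψ : Fock (Orb (FermionTorus 2 L)),
          IsGroundStateInSector (hubbardTorus 2 L 1 U) (2 * ⌊(1 - δ) * (L : ℝ) ^ 2 / 2⌋₊) 0 ψ →
          star ψ ⬝ᵥ ψ = 1 →
          ∀ (σ : Fin 2) (k k' : TorusSite 2 L),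
            |(expect (momentumNumber k σ) ψ).re - (expect (momentumNumber k' σ) ψ).re| ≤
              K * torusDist k k' / L := by
  obtain ⟨U, hU, δ, hδ, hPG, -⟩ := hW
  obtain ⟨K, hK, L₀, h⟩ := momentumDistribution_lipschitz_of_parityGap_clause U δ hPG
  exact ⟨U, hU, δ, hδ, K, hK, L₀, h⟩

/-- **A Migdal discontinuity refutes the (PG) clause** (sufficient condition for the kill criterion
`NoUniformParityGap`, stmt-2198, at one point `(U, δ)`): if there is `z > 0` such that for every
threshold `L₀` some even side `L ≥ L₀` carries a normalised `(N_L, 0)`-sector ground state of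
`hubbardTorus 2 L 1 U` and two Bloch momenta at dual distance `≤ 1` whose occupations differ by at
least `z`, then the model has NO `L`-uniform parity gap at `(U, δ)`. Proof: the Lipschitz bound
gives `z ≤ K/L` for arbitrarily large `L`. -/
theorem not_parityGap_clause_of_fermiJump (U δ : ℝ)
    (hjump : ∃ z : ℝ, 0 < z ∧ ∀ L₀ : ℕ, ∃ (L : ℕ) (_ : NeZero L), L₀ ≤ L ∧ Even L ∧
      ∃ ψ : Fock (Orb (FermionTorus 2 L)),
        IsGroundStateInSector (hubbardTorus 2 L 1 U) (2 * ⌊(1 - δ) * (L : ℝ) ^ 2 / 2⌋₊) 0 ψ ∧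
        star ψ ⬝ᵥ ψ = 1 ∧
        ∃ (σ : Fin 2) (k k' : TorusSite 2 L), torusDist k k' ≤ 1 ∧
          z ≤ |(expect (momentumNumber k σ) ψ).re - (expect (momentumNumber k' σ) ψ).re|) :
    ¬ (∃ Δ : ℝ, 0 < Δ ∧ ∃ L₀ : ℕ, ∀ L ≥ L₀, Even L → ∀ Hm, Hm = hubbardTorus 2 L 1 U →
      2 * Δ ≤ groundEnergy Hm (2 * ⌊(1 - δ) * (L : ℝ) ^ 2 / 2⌋₊ + 1) +
        groundEnergy Hm (2 * ⌊(1 - δ) * (L : ℝ) ^ 2 / 2⌋₊ - 1) -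
        2 * Matrix.minEnergyOn Hm (szSector (2 * ⌊(1 - δ) * (L : ℝ) ^ 2 / 2⌋₊) 0)) := by
  intro hPG
  obtain ⟨z, hz, hj⟩ := hjump
  obtain ⟨K, hK, L₀, hlip⟩ := momentumDistribution_lipschitz_of_parityGap_clause U δ hPG
  -- a side beyond both the threshold `L₀` and `K / z`
  obtain ⟨L₁, hL₁⟩ := exists_nat_gt (K / z)
  obtain ⟨L, hLne, hL, hev, ψ, hgs, hψ1, σ, k, k', hkk, hzle⟩ := hj (max L₀ L₁)
  have hL0 : L₀ ≤ L := le_of_max_le_left hL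
  have hL1 : L₁ ≤ L := le_of_max_le_right hL
  have hLpos : (0 : ℝ) < L := Nat.cast_pos.2 (Nat.pos_of_ne_zero (NeZero.ne L))
  have hbound := hlip L hL0 hev ψ hgs hψ1 σ k k'
  -- `z ≤ K · dist / L ≤ K / L < z`
  have h1 : K * (torusDist k k' : ℝ) / L ≤ K / L := by
    rw [div_le_div_iff_of_pos_right hLpos]
    calc K * (torusDist k k' : ℝ) ≤ K * 1 :=
          mul_le_mul_of_nonneg_left (by exact_mod_cast hkk) hK
      _ = K := mul_one K
  have h2 : K / L < z := by
    have hKz : K / z < L := hL₁.trans_le (by exact_mod_cast hL1)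
    rw [div_lt_iff₀ hz] at hKz
    rw [div_lt_iff₀ hLpos]
    linarith [mul_comm z (L : ℝ)]
  linarith [hzle.trans (hbound.trans h1)]

/-- **A Migdal discontinuity at every `(U, δ)` refutes `GappedWindow`** (the crux BY NAME): if at
every `U > 0`, `δ ∈ (0, 1/2)` the momentum distribution of the `(N_L, 0)`-sector ground states keeps a
jump `z(U, δ) > 0` between momenta at dual distance `≤ 1` along infinitely many even `L`, then the
window does not exist. (This is how a proof of "the pure `t' = 0` model is a Landau Fermi liquid at
every doping" would close the route negatively, through the quasiparticle residue alone.) -/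
theorem not_gappedWindow_of_forall_fermiJump
    (hjump : ∀ (U δ : ℝ), 0 < U → δ ∈ Set.Ioo (0 : ℝ) (1 / 2) →
      ∃ z : ℝ, 0 < z ∧ ∀ L₀ : ℕ, ∃ (L : ℕ) (_ : NeZero L), L₀ ≤ L ∧ Even L ∧
        ∃ ψ : Fock (Orb (FermionTorus 2 L)),
          IsGroundStateInSector (hubbardTorus 2 L 1 U) (2 * ⌊(1 - δ) * (L : ℝ) ^ 2 / 2⌋₊) 0 ψ ∧
          star ψ ⬝ᵥ ψ = 1 ∧
          ∃ (σ : Fin 2) (k k' : TorusSite 2 L), torusDist k k' ≤ 1 ∧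
            z ≤ |(expect (momentumNumber k σ) ψ).re - (expect (momentumNumber k' σ) ψ).re|) :
    ¬ GappedWindow := by
  rintro ⟨U, hU, δ, hδ, hPG, -⟩
  exact not_parityGap_clause_of_fermiJump U δ (hjump U δ hU hδ) hPG

end Summit.HubbardSuperconductivity.HubbardSuperconductivity.Theorems

end
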